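import Summits.Ventures.CertifiedManyBodySolver.Downfold.BoxesLa214V115M2c
import Summits.Ventures.CertifiedManyBodySolver.Observables.StiffnessApexTransportCurtainTopTargetSlot
import Summits.Ventures.CertifiedManyBodySolver.Observables.StiffnessApexTransportCurtainTopLaBoxE
import HarnessLib

/-!
# M2(c) closers from the (E6) curtain at ANY DENSITY — «station 29/5 + SHORT overhang + LEFT-EDGE TOP», lever-free (`boxLa214E_M15v115`,
# La₂₋ₓSrₓCuO₄ x = 0.125, object E: `[−3/10, −1/5] × [29/5, 74/5] × n ∈ [171/200, 179/200]`)

Venture CertifiedManyBodySolver, cell `pub/hubbard-downfold` (MO-S1 ↔ S2 seam; D-0154 (1)(C) COVERAGE, La214 M2(b)/(c) depth «LSCO x = 1/8» / «74/5 insurance»);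
namespace `Summit.Ventures.CertifiedManyBodySolver.Downfold`; seat `hubbard-cov-la214-unc-2` (`prover-hubbard-cov-la214-unc-2-0`). Companion of
`Downfold/BoxesLa214V115M2cTargetSlot.lean` (seat hubbard-downfold-unc-2 g15: the one-station target-slot M2(c) closers, source segment to `−357/740`) and of
`Observables/StiffnessApexTransportCurtainTopTargetSlot.lean` (this seat: the any-density two-window curtain and (E6)).

WHAT (E6) CHANGES for the doped box: the one station `29/5` is read on `[−153/400, −1/5]` only (inner `[−3/10, −1/5]` + short overhang `[−153/400, −3/10]`, window
height `U_L = 8`) instead of `[−357/740, −1/5]`, and the top slab is served by a `U`-family on `{−3/10} × [8, 74/5]`; every family is read at the TARGET slot `σ`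
(two end-objective reads per vertex), so there is NO lever and NO `K₂` word at any density (as in the companion). ONE-`exact` CLOSERS of the M2(c) stiffness word
`HoldsOn (p ↦ ObsStiffnessSeqCeilingAt (p tp) (p U) (p n) c) boxLa214E_M15v115`:
* `boxLa214E_M15v115_stiffnessWord_of_apexStation29o5_shortOverhang_and_leftEdgeTop_targetSlot_doped` — any window height `U_L ≥ 29/5`;
* `boxLa214E_M15v115_stiffnessWord_of_apexStation29o5_shortOverhang153o400_and_leftEdgeTop8_targetSlot_doped` — `U_L = 8`.

Everything here is PROVED; no `sorry`, no definition. HONEST FRAMING: one-sided stiffness CEILINGS conditional BY NAME on families no producer has delivered yet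
(CONTROL/CALIBRATION class; a ceiling is silent on `ρ_s = 0` and on pairing); typing certifies nothing about La₂₋ₓSrₓCuO₄; no summit statement is proved here;
no phase sentence; no number of record.
-/

noncomputable section

namespace Summit.Ventures.CertifiedManyBodySolver.Downfold

open Set NonemptyInterval Filter
open Summit.Ventures.CertifiedManyBodySolver.Observables
open Summit.Ventures.CertifiedManyBodySolver.Certificates
open Literature.MathematicalPhysics.QuantumLattice Literature.MathematicalPhysics.QuantumLattice.ThermodynamicLimit
open Literature.Probability.LatticeModels

/-- **M2(c) CLOSER — (E6) AT ANY DENSITY, any window height `U_L ≥ 29/5`, lever-free.** For every density `x ∈ [171/200, 179/200]` and every target slot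
`σ ∈ [−3/10, −1/5]`: a BOTTOM family `valI x σ s` on the classes at `(s, 29/5, x)`, `s ∈ [−3/10, σ]`; a SHORT-OVERHANG family `valO x σ s` on the classes at
`(s, 29/5, x)`, `s ∈ [(−3/10)(2 − (29/5)/U_L), −3/10]`; a LEFT-TOP family `valL x σ U'` on the classes at `(−3/10, U', x)`, `U' ∈ [U_L, 74/5]`; all unconditional
orbit-lower statements for the objective `−X₀(σ, ·)` with `−val ≤ c`. Then the stiffness word `c` holds on `boxLa214E_M15v115`.
[cite: KomaTasaki1994, §1] [cite: ScalapinoWhiteZhang1993, §II] -/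
theorem boxLa214E_M15v115_stiffnessWord_of_apexStation29o5_shortOverhang_and_leftEdgeTop_targetSlot_doped (UL : ℝ) (hAL : 29 / 5 ≤ UL)
    (valI valO valL : ℝ → ℝ → ℝ → ℝ) (c : ℚ)
    (hI : ∀ x ∈ Set.Icc (171 / 200 : ℝ) (179 / 200), ∀ σ ∈ Set.Icc (-3 / 10 : ℝ) (-1 / 5), ∀ s ∈ Set.Icc (-3 / 10 : ℝ) σ,
      ∀ (ω : InfVolFermionState 2) (Ls : ℕ → ℕ) (ψ : ∀ L, Fock (Orb (FermionTorus 2 L))),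
      Tendsto Ls atTop atTop →
      (∀ j, IsGroundStateInSector (hubbardTorusTT' (Ls j) 1 s (29 / 5)) (rectN x (Ls j)) 0 (ψ (Ls j))) →
      (∀ j, star (ψ (Ls j)) ⬝ᵥ ψ (Ls j) = 1) → ω.IsTorusLimitOf ψ Ls →
      valI x σ s ≤ ((Finset.univ : Finset (DihedralGroup 4)).card : ℝ)⁻¹ * ∑ g ∈ (Finset.univ : Finset (DihedralGroup 4)),
        (ω.expect (d4ShiftSet g 0 (Literature.Probability.LatticeModels.box 2 7))
          (fermionEmbed (PolySite.d4Emb g 0 (Literature.Probability.LatticeModels.box 2 7)) (-oddMomentObsTT σ (29 / 5) 0))).re)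
    (hcI : ∀ x ∈ Set.Icc (171 / 200 : ℝ) (179 / 200), ∀ σ ∈ Set.Icc (-3 / 10 : ℝ) (-1 / 5), ∀ s ∈ Set.Icc (-3 / 10 : ℝ) σ,
      -valI x σ s ≤ ((c : ℚ) : ℝ))
    (hO : ∀ x ∈ Set.Icc (171 / 200 : ℝ) (179 / 200), ∀ σ ∈ Set.Icc (-3 / 10 : ℝ) (-1 / 5),
      ∀ s ∈ Set.Icc (-3 / 10 * (2 - 29 / 5 / UL) : ℝ) (-3 / 10),
      ∀ (ω : InfVolFermionState 2) (Ls : ℕ → ℕ) (ψ : ∀ L, Fock (Orb (FermionTorus 2 L))),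
      Tendsto Ls atTop atTop →
      (∀ j, IsGroundStateInSector (hubbardTorusTT' (Ls j) 1 s (29 / 5)) (rectN x (Ls j)) 0 (ψ (Ls j))) →
      (∀ j, star (ψ (Ls j)) ⬝ᵥ ψ (Ls j) = 1) → ω.IsTorusLimitOf ψ Ls →
      valO x σ s ≤ ((Finset.univ : Finset (DihedralGroup 4)).card : ℝ)⁻¹ * ∑ g ∈ (Finset.univ : Finset (DihedralGroup 4)),
        (ω.expect (d4ShiftSet g 0 (Literature.Probability.LatticeModels.box 2 7))
          (fermionEmbed (PolySite.d4Emb g 0 (Literature.Probability.LatticeModels.box 2 7)) (-oddMomentObsTT σ (29 / 5) 0))).re)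
    (hcO : ∀ x ∈ Set.Icc (171 / 200 : ℝ) (179 / 200), ∀ σ ∈ Set.Icc (-3 / 10 : ℝ) (-1 / 5),
      ∀ s ∈ Set.Icc (-3 / 10 * (2 - 29 / 5 / UL) : ℝ) (-3 / 10), -valO x σ s ≤ ((c : ℚ) : ℝ))
    (hL : ∀ x ∈ Set.Icc (171 / 200 : ℝ) (179 / 200), ∀ σ ∈ Set.Icc (-3 / 10 : ℝ) (-1 / 5), ∀ U' ∈ Set.Icc UL (74 / 5),
      ∀ (ω : InfVolFermionState 2) (Ls : ℕ → ℕ) (ψ : ∀ L, Fock (Orb (FermionTorus 2 L))),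
      Tendsto Ls atTop atTop →
      (∀ j, IsGroundStateInSector (hubbardTorusTT' (Ls j) 1 (-3 / 10) U') (rectN x (Ls j)) 0 (ψ (Ls j))) →
      (∀ j, star (ψ (Ls j)) ⬝ᵥ ψ (Ls j) = 1) → ω.IsTorusLimitOf ψ Ls →
      valL x σ U' ≤ ((Finset.univ : Finset (DihedralGroup 4)).card : ℝ)⁻¹ * ∑ g ∈ (Finset.univ : Finset (DihedralGroup 4)),
        (ω.expect (d4ShiftSet g 0 (Literature.Probability.LatticeModels.box 2 7))
          (fermionEmbed (PolySite.d4Emb g 0 (Literature.Probability.LatticeModels.box 2 7)) (-oddMomentObsTT σ U' 0))).re)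
    (hcL : ∀ x ∈ Set.Icc (171 / 200 : ℝ) (179 / 200), ∀ σ ∈ Set.Icc (-3 / 10 : ℝ) (-1 / 5), ∀ U' ∈ Set.Icc UL (74 / 5),
      -valL x σ U' ≤ ((c : ℚ) : ℝ)) :
    HoldsOn (fun p : OneBandCoord → ℝ => ObsStiffnessSeqCeilingAt (p .tpOverT) (p .UOverT) (p .filling) c)
      boxLa214E_M15v115 := by
  refine boxLa214E_M15v115_stiffnessWord_of_cellLeaf fun tp htp U hU n hn => ?_
  exact ObsStiffnessSeqCeilingAt_on_box_of_apexStation_shortOverhang_and_leftEdgeTop_targetSlot (p := -3 / 10) (q := -1 / 5) (UA := 29 / 5)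
    (UL := UL) (Umax := 74 / 5) (n := n) (by norm_num) hAL (by norm_num) (by linarith [hn.1]) (by linarith [hn.2]) (valI n) (valO n) (valL n) c
    (hI n hn) (hcI n hn) (hO n hn) (hcO n hn) (hL n hn) (hcL n hn) tp htp U hU

/-- **M2(c) CLOSER — (E6) AT ANY DENSITY with `U_L = 8`: short overhang `[−153/400, −3/10] × {29/5}`, left-top `{−3/10} × [8, 74/5]`, lever-free.** As above
with the overhang domain written `[−153/400, −3/10]`. [cite: KomaTasaki1994, §1] [cite: ScalapinoWhiteZhang1993, §II] -/
theorem boxLa214E_M15v115_stiffnessWord_of_apexStation29o5_shortOverhang153o400_and_leftEdgeTop8_targetSlot_doped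
    (valI valO valL : ℝ → ℝ → ℝ → ℝ) (c : ℚ)
    (hI : ∀ x ∈ Set.Icc (171 / 200 : ℝ) (179 / 200), ∀ σ ∈ Set.Icc (-3 / 10 : ℝ) (-1 / 5), ∀ s ∈ Set.Icc (-3 / 10 : ℝ) σ,
      ∀ (ω : InfVolFermionState 2) (Ls : ℕ → ℕ) (ψ : ∀ L, Fock (Orb (FermionTorus 2 L))),
      Tendsto Ls atTop atTop →
      (∀ j, IsGroundStateInSector (hubbardTorusTT' (Ls j) 1 s (29 / 5)) (rectN x (Ls j)) 0 (ψ (Ls j))) →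
      (∀ j, star (ψ (Ls j)) ⬝ᵥ ψ (Ls j) = 1) → ω.IsTorusLimitOf ψ Ls →
      valI x σ s ≤ ((Finset.univ : Finset (DihedralGroup 4)).card : ℝ)⁻¹ * ∑ g ∈ (Finset.univ : Finset (DihedralGroup 4)),
        (ω.expect (d4ShiftSet g 0 (Literature.Probability.LatticeModels.box 2 7))
          (fermionEmbed (PolySite.d4Emb g 0 (Literature.Probability.LatticeModels.box 2 7)) (-oddMomentObsTT σ (29 / 5) 0))).re)
    (hcI : ∀ x ∈ Set.Icc (171 / 200 : ℝ) (179 / 200), ∀ σ ∈ Set.Icc (-3 / 10 : ℝ) (-1 / 5), ∀ s ∈ Set.Icc (-3 / 10 : ℝ) σ,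
      -valI x σ s ≤ ((c : ℚ) : ℝ))
    (hO : ∀ x ∈ Set.Icc (171 / 200 : ℝ) (179 / 200), ∀ σ ∈ Set.Icc (-3 / 10 : ℝ) (-1 / 5), ∀ s ∈ Set.Icc (-(153 / 400) : ℝ) (-3 / 10),
      ∀ (ω : InfVolFermionState 2) (Ls : ℕ → ℕ) (ψ : ∀ L, Fock (Orb (FermionTorus 2 L))),
      Tendsto Ls atTop atTop →
      (∀ j, IsGroundStateInSector (hubbardTorusTT' (Ls j) 1 s (29 / 5)) (rectN x (Ls j)) 0 (ψ (Ls j))) →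
      (∀ j, star (ψ (Ls j)) ⬝ᵥ ψ (Ls j) = 1) → ω.IsTorusLimitOf ψ Ls →
      valO x σ s ≤ ((Finset.univ : Finset (DihedralGroup 4)).card : ℝ)⁻¹ * ∑ g ∈ (Finset.univ : Finset (DihedralGroup 4)),
        (ω.expect (d4ShiftSet g 0 (Literature.Probability.LatticeModels.box 2 7))
          (fermionEmbed (PolySite.d4Emb g 0 (Literature.Probability.LatticeModels.box 2 7)) (-oddMomentObsTT σ (29 / 5) 0))).re)
    (hcO : ∀ x ∈ Set.Icc (171 / 200 : ℝ) (179 / 200), ∀ σ ∈ Set.Icc (-3 / 10 : ℝ) (-1 / 5), ∀ s ∈ Set.Icc (-(153 / 400) : ℝ) (-3 / 10),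
      -valO x σ s ≤ ((c : ℚ) : ℝ))
    (hL : ∀ x ∈ Set.Icc (171 / 200 : ℝ) (179 / 200), ∀ σ ∈ Set.Icc (-3 / 10 : ℝ) (-1 / 5), ∀ U' ∈ Set.Icc (8 : ℝ) (74 / 5),
      ∀ (ω : InfVolFermionState 2) (Ls : ℕ → ℕ) (ψ : ∀ L, Fock (Orb (FermionTorus 2 L))),
      Tendsto Ls atTop atTop →
      (∀ j, IsGroundStateInSector (hubbardTorusTT' (Ls j) 1 (-3 / 10) U') (rectN x (Ls j)) 0 (ψ (Ls j))) →
      (∀ j, star (ψ (Ls j)) ⬝ᵥ ψ (Ls j) = 1) → ω.IsTorusLimitOf ψ Ls →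
      valL x σ U' ≤ ((Finset.univ : Finset (DihedralGroup 4)).card : ℝ)⁻¹ * ∑ g ∈ (Finset.univ : Finset (DihedralGroup 4)),
        (ω.expect (d4ShiftSet g 0 (Literature.Probability.LatticeModels.box 2 7))
          (fermionEmbed (PolySite.d4Emb g 0 (Literature.Probability.LatticeModels.box 2 7)) (-oddMomentObsTT σ U' 0))).re)
    (hcL : ∀ x ∈ Set.Icc (171 / 200 : ℝ) (179 / 200), ∀ σ ∈ Set.Icc (-3 / 10 : ℝ) (-1 / 5), ∀ U' ∈ Set.Icc (8 : ℝ) (74 / 5),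
      -valL x σ U' ≤ ((c : ℚ) : ℝ)) :
    HoldsOn (fun p : OneBandCoord → ℝ => ObsStiffnessSeqCeilingAt (p .tpOverT) (p .UOverT) (p .filling) c)
      boxLa214E_M15v115 := by
  refine boxLa214E_M15v115_stiffnessWord_of_apexStation29o5_shortOverhang_and_leftEdgeTop_targetSlot_doped 8 (by norm_num) valI valO valL c
    hI hcI (fun x hx σ hσ s hs => ?_) (fun x hx σ hσ s hs => ?_) hL hcL
  · rw [laBoxE_leftTop8_overhang] at hs; exact hO x hx σ hσ s hs
  · rw [laBoxE_leftTop8_overhang] at hs; exact hcO x hx σ hσ s hs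

end Summit.Ventures.CertifiedManyBodySolver.Downfold

end
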